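import Summits.AtomisticToContinuum.HydrodynamicLimit.Theses.LaxScheme
import HarnessLib

/-!
# Birth skeleton — crux `LaxScheme.SmoothedTrajectoryRegularity` (stmt-AtomisticToContinuum-18701; split child 3 of `LaxShadowing`)

BC3 of the strategist's decomposition (2026-08-17). Two named stubs and the composition
`SmoothedTrajectoryRegularity_of` (kernel-checked; sorries only inside the stubs):

* `stub_distIntegrableOnGood` — for EVERY good orbit (no energy shell, any `N`): `r ↦ DIST(r) = sup_x ‖smoothed error‖`
  is integrable on `[0,t]` (right-continuous orbit with finitely many collisions in `[0,t]`; the error is continuous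
  in `x`, so the sup is a countable sup of measurable functions; bounded at fixed `N` by energy conservation).
* `stub_oscillationScale` — the JUMP SCALE: for every energy level `B` there is a deterministic `J : ℕ → ℝ`, `J → 0`
  (e.g. `2·Lip(k_λ)·σ(N+1)^{-1/3}·(B + 2√(2B))`), such that every good orbit on the shell has `(τ, j)`-oscillation for
  every `j > J N` (binary collisions move the smoothed momentum/energy fields by `≤ J N / 2`; positions are continuous;
  finitely many collision times in `[0,t]`; free flight is Lipschitz in `r` at fixed `N`).
* `SmoothedTrajectoryRegularity_of` — composition: `N₀` from `J → 0` (`J N < j` eventually), then both stubs.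
-/

noncomputable section

namespace Summit.AtomisticToContinuum.HydrodynamicLimit.Cruxes.SmoothedTrajectoryRegularity.Birth

open Set Filter Topology MeasureTheory

/-- STUB A: integrability of the sup-error along every good orbit. [cite: Alexander1975] -/
theorem stub_distIntegrableOnGood : ∀ lam : ℝ, 0 < lam → lam ≤ 1 / 4 → ∀ σ : ℝ, 0 < σ → ∀ (T : ℝ) (ρ θ : ℝ → UnitAddTorus (Fin 3) → ℝ) (u : ℝ → UnitAddTorus (Fin 3) → EuclideanSpace ℝ (Fin 3)), Literature.MathematicalPhysics.KineticTheory.IsHardSphereEulerSolution σ T ρ u θ → ∀ t ∈ Set.Ico 0 T, let k : UnitAddTorus (Fin 3) → ℝ := Literature.Analysis.FunctionSpaces.Torus.kernel lam; let VN := fun {n : ℕ} (z : Literature.Analysis.FluidPDE.Config n (Fin 3) (UnitAddTorus (Fin 3))) (x : UnitAddTorus (Fin 3)) => (Literature.MathematicalPhysics.KineticTheory.empiricalDensityField z (fun y => k (x - y)), Literature.MathematicalPhysics.KineticTheory.empiricalMomentumField z (fun y => k (x - y)), Literature.MathematicalPhysics.KineticTheory.empiricalEnergyField z (fun y => k (x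 - y))); let VB := fun (r : ℝ) (x : UnitAddTorus (Fin 3)) => (∫ y, k (x - y) * ρ r y, ∫ y, (k (x - y) * ρ r y) • u r y, ∫ y, k (x - y) * Literature.MathematicalPhysics.KineticTheory.totalEnergyDensity (ρ r y) (u r y) (θ r y)); let d := fun (V : ℝ → UnitAddTorus (Fin 3) → ℝ × EuclideanSpace ℝ (Fin 3) × ℝ) (r : ℝ) (x : UnitAddTorus (Fin 3)) => V r x - VB r x; let DIST := fun (V : ℝ → UnitAddTorus (Fin 3) → ℝ × EuclideanSpace ℝ (Fin 3) × ℝ) (r : ℝ) => ⨆ x : UnitAddTorus (Fin 3), ‖d V r x‖; ∀ N : ℕ, ∀ Φ : Literature.Analysis.FluidPDE.HardSphereFlow (Literature.Analysis.FluidPDE.Torus.geometry (Fin 3)) (Literature.MathematicalPhysics.KineticTheory.hsDiameter σ N) (N + 1), ∀ z ∈ Φ.good, MeasureTheory.IntegrableOn (fun r => DIST (fun r' => VN (Φ.flow r' z)) r) (Set.Icc 0 t) MeasureTheory.volume := by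
  sorry

/-- STUB B: the deterministic jump scale `J → 0` on the energy shell and the `(τ, j)`-oscillation for `j > J N`.
[cite: GST2013, Prop. 4.1.1] -/
theorem stub_oscillationScale : ∀ lam : ℝ, 0 < lam → lam ≤ 1 / 4 → ∀ σ : ℝ, 0 < σ → ∀ (T : ℝ) (ρ θ : ℝ → UnitAddTorus (Fin 3) → ℝ) (u : ℝ → UnitAddTorus (Fin 3) → EuclideanSpace ℝ (Fin 3)), Literature.MathematicalPhysics.KineticTheory.IsHardSphereEulerSolution σ T ρ u θ → ∀ t ∈ Set.Ico 0 T, let k : UnitAddTorus (Fin 3) → ℝ := Literature.Analysis.FunctionSpaces.Torus.kernel lam; let VN := fun {n : ℕ} (z : Literature.Analysis.FluidPDE.Config n (Fin 3) (UnitAddTorus (Fin 3))) (x : UnitAddTorus (Fin 3)) => (Literature.MathematicalPhysics.KineticTheory.empiricalDensityField z (fun y => k (x - y)), Literature.MathematicalPhysics.KineticTheory.empiricalMomentumField z (fun y => k (x - y)), Literature.MathematicalPhysics.KineticTheory.empiricalEnergyField z (fun y => k (x - y))); let VB := fun (r : ℝ) (x : UnitAddTorus (Fin 3)) => (∫ y,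 k (x - y) * ρ r y, ∫ y, (k (x - y) * ρ r y) • u r y, ∫ y, k (x - y) * Literature.MathematicalPhysics.KineticTheory.totalEnergyDensity (ρ r y) (u r y) (θ r y)); let d := fun (V : ℝ → UnitAddTorus (Fin 3) → ℝ × EuclideanSpace ℝ (Fin 3) × ℝ) (r : ℝ) (x : UnitAddTorus (Fin 3)) => V r x - VB r x; ∀ B : ℝ, 0 < B → ∃ J : ℕ → ℝ, Filter.Tendsto J Filter.atTop (nhds 0) ∧ ∀ N : ℕ, ∀ Φ : Literature.Analysis.FluidPDE.HardSphereFlow (Literature.Analysis.FluidPDE.Torus.geometry (Fin 3)) (Literature.MathematicalPhysics.KineticTheory.hsDiameter σ N) (N + 1), ∀ z ∈ Φ.good, (∀ r ∈ Set.Icc 0 t, Literature.Analysis.FluidPDE.configEnergy (Φ.flow r z) ≤ B * ((N : ℝ) + 1)) → ∀ j : ℝ, J N < j → ∃ τ : ℝ, 0 < τ ∧ ∀ r ∈ Set.Icc 0 t, ∀ r' ∈ Set.Icc 0 t, |r' - r| ≤ τ → ∀ x, ‖d (fun r' => VN (Φ.flow r' z)) r' x - d (fun r' => VN (Φ.flow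 r' z)) r x‖ ≤ j := by
  sorry

/-- **Composition**: the two stubs give the crux `SmoothedTrajectoryRegularity`. [cite: Alexander1975] -/
theorem SmoothedTrajectoryRegularity_of_subs : (∀ lam : ℝ, 0 < lam → lam ≤ 1 / 4 → ∀ σ : ℝ, 0 < σ → ∀ (T : ℝ) (ρ θ : ℝ → UnitAddTorus (Fin 3) → ℝ) (u : ℝ → UnitAddTorus (Fin 3) → EuclideanSpace ℝ (Fin 3)), Literature.MathematicalPhysics.KineticTheory.IsHardSphereEulerSolution σ T ρ u θ → ∀ t ∈ Set.Ico 0 T, let k : UnitAddTorus (Fin 3) → ℝ := Literature.Analysis.FunctionSpaces.Torus.kernel lam; let VN := fun {n : ℕ} (z : Literature.Analysis.FluidPDE.Config n (Fin 3) (UnitAddTorus (Fin 3))) (x : UnitAddTorus (Fin 3)) => (Literature.MathematicalPhysics.KineticTheory.empiricalDensityField z (fun y => k (x - y)), Literature.MathematicalPhysics.KineticTheory.empiricalMomentumField z (fun y => k (x - y)), Literature.MathematicalPhysics.KineticTheory.empiricalEnergyField z (fun y => k (x - y))); let VB := fun (r : ℝ) (x : UnitAddTorus (Fin 3)) => (∫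 y, k (x - y) * ρ r y, ∫ y, (k (x - y) * ρ r y) • u r y, ∫ y, k (x - y) * Literature.MathematicalPhysics.KineticTheory.totalEnergyDensity (ρ r y) (u r y) (θ r y)); let d := fun (V : ℝ → UnitAddTorus (Fin 3) → ℝ × EuclideanSpace ℝ (Fin 3) × ℝ) (r : ℝ) (x : UnitAddTorus (Fin 3)) => V r x - VB r x; let DIST := fun (V : ℝ → UnitAddTorus (Fin 3) → ℝ × EuclideanSpace ℝ (Fin 3) × ℝ) (r : ℝ) => ⨆ x : UnitAddTorus (Fin 3), ‖d V r x‖; ∀ N : ℕ, ∀ Φ : Literature.Analysis.FluidPDE.HardSphereFlow (Literature.Analysis.FluidPDE.Torus.geometry (Fin 3)) (Literature.MathematicalPhysics.KineticTheory.hsDiameter σ N) (N + 1), ∀ z ∈ Φ.good, MeasureTheory.IntegrableOn (fun r => DIST (fun r' => VN (Φ.flow r' z)) r) (Set.Icc 0 t) MeasureTheory.volume) → (∀ lam : ℝ, 0 < lam → lam ≤ 1 / 4 → ∀ σ : ℝ, 0 < σ → ∀ (T : ℝ) (ρ θ : ℝ → UnitAddTorus (Fin 3) → ℝ) (u : ℝ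 → UnitAddTorus (Fin 3) → EuclideanSpace ℝ (Fin 3)), Literature.MathematicalPhysics.KineticTheory.IsHardSphereEulerSolution σ T ρ u θ → ∀ t ∈ Set.Ico 0 T, let k : UnitAddTorus (Fin 3) → ℝ := Literature.Analysis.FunctionSpaces.Torus.kernel lam; let VN := fun {n : ℕ} (z : Literature.Analysis.FluidPDE.Config n (Fin 3) (UnitAddTorus (Fin 3))) (x : UnitAddTorus (Fin 3)) => (Literature.MathematicalPhysics.KineticTheory.empiricalDensityField z (fun y => k (x - y)), Literature.MathematicalPhysics.KineticTheory.empiricalMomentumField z (fun y => k (x - y)), Literature.MathematicalPhysics.KineticTheory.empiricalEnergyField z (fun y => k (x - y))); let VB := fun (r : ℝ) (x : UnitAddTorus (Fin 3)) => (∫ y, k (x - y) * ρ r y, ∫ y, (k (x - y) * ρ r y) • u r y, ∫ y, k (x - y) * Literature.MathematicalPhysics.KineticTheory.totalEnergyDensity (ρ r y) (u r y) (θ r y)); let d := fun (V : ℝ → UnitAddTorus (Fin 3) → ℝ × EuclideanSpace ℝ (Fin 3) × ℝ) (r : ℝ) (x : UnitAddTorus (Fin 3)) => V r x - VB r x; ∀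 B : ℝ, 0 < B → ∃ J : ℕ → ℝ, Filter.Tendsto J Filter.atTop (nhds 0) ∧ ∀ N : ℕ, ∀ Φ : Literature.Analysis.FluidPDE.HardSphereFlow (Literature.Analysis.FluidPDE.Torus.geometry (Fin 3)) (Literature.MathematicalPhysics.KineticTheory.hsDiameter σ N) (N + 1), ∀ z ∈ Φ.good, (∀ r ∈ Set.Icc 0 t, Literature.Analysis.FluidPDE.configEnergy (Φ.flow r z) ≤ B * ((N : ℝ) + 1)) → ∀ j : ℝ, J N < j → ∃ τ : ℝ, 0 < τ ∧ ∀ r ∈ Set.Icc 0 t, ∀ r' ∈ Set.Icc 0 t, |r' - r| ≤ τ → ∀ x, ‖d (fun r' => VN (Φ.flow r' z)) r' x - d (fun r' => VN (Φ.flow r' z)) r x‖ ≤ j) → (∀ lam : ℝ, 0 < lam → lam ≤ 1 / 4 → ∀ σ : ℝ, 0 < σ → ∀ (T : ℝ) (ρ θ : ℝ → UnitAddTorus (Fin 3) → ℝ) (u : ℝ → UnitAddTorus (Fin 3) → EuclideanSpace ℝ (Fin 3)), Literature.MathematicalPhysics.KineticTheory.IsHardSphereEulerSolution σ T ρ u θ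 → ∀ t ∈ Set.Ico 0 T, let k : UnitAddTorus (Fin 3) → ℝ := Literature.Analysis.FunctionSpaces.Torus.kernel lam; let VN := fun {n : ℕ} (z : Literature.Analysis.FluidPDE.Config n (Fin 3) (UnitAddTorus (Fin 3))) (x : UnitAddTorus (Fin 3)) => (Literature.MathematicalPhysics.KineticTheory.empiricalDensityField z (fun y => k (x - y)), Literature.MathematicalPhysics.KineticTheory.empiricalMomentumField z (fun y => k (x - y)), Literature.MathematicalPhysics.KineticTheory.empiricalEnergyField z (fun y => k (x - y))); let VB := fun (r : ℝ) (x : UnitAddTorus (Fin 3)) => (∫ y, k (x - y) * ρ r y, ∫ y, (k (x - y) * ρ r y) • u r y, ∫ y, k (x - y) * Literature.MathematicalPhysics.KineticTheory.totalEnergyDensity (ρ r y) (u r y) (θ r y)); let d := fun (V : ℝ → UnitAddTorus (Fin 3) → ℝ × EuclideanSpace ℝ (Fin 3) × ℝ) (r : ℝ) (x : UnitAddTorus (Fin 3)) => V r x - VB r x; let DIST := fun (V : ℝ → UnitAddTorus (Fin 3) → ℝ × EuclideanSpace ℝ (Fin 3) × ℝ) (r : ℝ) => ⨆ x : UnitAddTorus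 (Fin 3), ‖d V r x‖; ∀ B : ℝ, 0 < B → ∀ j : ℝ, 0 < j → ∃ N₀ : ℕ, ∀ N : ℕ, N₀ ≤ N → ∀ Φ : Literature.Analysis.FluidPDE.HardSphereFlow (Literature.Analysis.FluidPDE.Torus.geometry (Fin 3)) (Literature.MathematicalPhysics.KineticTheory.hsDiameter σ N) (N + 1), ∀ z ∈ Φ.good, (∀ r ∈ Set.Icc 0 t, Literature.Analysis.FluidPDE.configEnergy (Φ.flow r z) ≤ B * ((N : ℝ) + 1)) → MeasureTheory.IntegrableOn (fun r => DIST (fun r' => VN (Φ.flow r' z)) r) (Set.Icc 0 t) MeasureTheory.volume ∧ ∃ τ : ℝ, 0 < τ ∧ ∀ r ∈ Set.Icc 0 t, ∀ r' ∈ Set.Icc 0 t, |r' - r| ≤ τ → ∀ x, ‖d (fun r' => VN (Φ.flow r' z)) r' x - d (fun r' => VN (Φ.flow r' z)) r x‖ ≤ j) := by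
  intro hA hB lam hlam hlam4 σ hσ T ρ θ u hsol t ht
  have HA := hA lam hlam hlam4 σ hσ T ρ θ u hsol t ht
  have HB := hB lam hlam hlam4 σ hσ T ρ θ u hsol t ht
  dsimp only at HA HB ⊢
  intro B hB' j hj
  obtain ⟨J, hJ, HB2⟩ := HB B hB'
  obtain ⟨N₀, hN₀⟩ := eventually_atTop.1 (hJ.eventually (eventually_lt_nhds hj))
  exact ⟨N₀, fun N hN Φ z hz hE => ⟨HA N Φ z hz, HB2 N Φ z hz hE j (hN₀ N hN)⟩⟩

/-- **The crux from the stubs.** [cite: Alexander1975] -/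
theorem SmoothedTrajectoryRegularity_of : Summit.AtomisticToContinuum.HydrodynamicLimit.Theses.LaxScheme.SmoothedTrajectoryRegularity :=
  SmoothedTrajectoryRegularity_of_subs stub_distIntegrableOnGood stub_oscillationScale

end Summit.AtomisticToContinuum.HydrodynamicLimit.Cruxes.SmoothedTrajectoryRegularity.Birth

end
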